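import Literature.AlgebraicGeometry.Frobenioids.BirationalizationIsFrobenioid
import HarnessLib

/-!
# Frobenioids I, Proposition 4.8 (iv) in the author's 2024 reading ("model type"): the birationalization
# of a Frobenioid of isotropic and model type is of (isotropic and) model type

Mochizuki, *The geometry of Frobenioids I: the general theory*, Kyushu J. Math. **62** (2008)
293–400, §4, Proposition 4.8 (iv), kurims text p. 88 [cite: MochizukiFrdI2008, Prop. 4.8 (iv) p.88]:
"(iv) If `C` is of isotropic and pre-model type, then so is `C^birat`", with the author's *Comments on
[FrdI]* (January 2024), item (29)(iv): "In Proposition 4.8, (iv): the phrase 'pre-model type' should read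
'model type'" — Def. 4.5 (i): "If `C` is of pre-model and birationally Frobenius-normalized type, then we
shall say that `C` is of model type" (abc-iut-L6-t8's `PreFrobenioid.IsOfModelType F hF hsq`).

PROOF-ONLY file (abc-iut cell; row W10-L07 of the sub-DAG `FrdI:Prop4.8(iv)`, unblocked by W14
`BirationalizationIsFrobenioid.lean`; seat abc-iut-w5-d227). The 2008 form ("pre-model") is
abc-iut-L6-t20's `Birat.prop48iv` / w5-d227's `prop48iv_biratData`; the 2024 form additionally asks that
`C^birat` be birationally Frobenius-normalized, i.e. that every `X^birat` be Frobenius-normalized in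
`(C^birat)^birat` — which presupposes that `C^birat` is a Frobenioid (W14, `Birat.isFrobenioid`, isotropic
+ birationally Frobenius-normalized `C`). For `C` isotropic, `E := C^birat → E^birat` is FULL on the image
(`exists_toBirat_birat_map_eq`: denominators of fractions of `E` are co-angular pre-steps of `E`, i.e.
isomorphisms), bases and degrees are preserved (Prop. 4.4 (iv)), so Frobenius-normalization of `X` in `E`
(the hypothesis "birationally Frobenius-normalized") passes to `X^birat` in `E^birat`
(`isFrobeniusNormalized_toBirat_birat_obj`). Results: `Birat.isOfModelType_toElemZero`,
**`Birat.prop48iv_model`** ([FrdI] Prop. 4.8 (iv), 2024 reading, for THE birationalization). No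
definitions; no statement of the paper is strengthened; nothing here concerns the disputed parts of IUT.
-/

namespace Literature.AlgebraicGeometry.Frobenioids

open CategoryTheory Opposite

universe w v v' u u'

namespace PreFrobenioid

namespace Birat

variable {D : Type u} [Category.{v} D] {Φ : Dᵒᵖ ⥤ CommMonCat.{w}}
  {C : Type u'} [Category.{v'} C] {F : C ⥤ ElemFrobenioid Φ}
  {hF : IsFrobenioid F} {hsq : HasBiratSquares F}

/-! ### `E := C^birat` (`C` isotropic) → `E^birat` is full -/

/-- For `C` of isotropic type and `E := C^birat → F_{0_D}` a Frobenioid (W14), every morphism of `E^birat`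
between images of objects of `E` is the image of a morphism of `E`: the denominator of a fraction of `E` is
a co-angular pre-step of `E`, i.e. an isomorphism, and `[(α, φ′)] = (α^birat)⁻¹ ≫ φ′^birat = (α⁻¹ ≫ φ′)^birat`.
[cite: MochizukiFrdI2008, Prop. 4.4 (iv) p.83] -/
theorem exists_toBirat_birat_map_eq (hiso : IsOfIsotropicType F) (hB : IsFrobenioid (toElemZero hF hsq))
    (hsqB : HasBiratSquares (toElemZero hF hsq)) {X Y : Birat F hF hsq}
    (φ : (toBirat (toElemZero hF hsq) hB hsqB).obj X ⟶ (toBirat (toElemZero hF hsq) hB hsqB).obj Y) :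
    ∃ ψ : X ⟶ Y, (toBirat (toElemZero hF hsq) hB hsqB).map ψ = φ := by
  obtain ⟨f, rfl⟩ := exists_homMk_eq φ
  haveI : IsIso f.den := (isCoAngularPreStep_iff_isIso hiso f.den).mp f.den_mem
  refine ⟨inv f.den ≫ f.num, ?_⟩
  rw [Functor.map_comp, Functor.map_inv, Birat.homMk_eq_inv_comp f]

/-! ### Frobenius-normalization passes from `E` to `E^birat` -/

/-- For `C` of isotropic type, `E := C^birat` a Frobenioid and `X ∈ Ob(E)` Frobenius-normalized in `E`,
the image `X^birat` is Frobenius-normalized in `E^birat → F_{(0_D)^gp}`: base-identity endomorphisms and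
elements of `O^▷` of `X^birat` are images of such of `X` (fullness; bases and degrees are preserved,
Prop. 4.4 (iv)), the normalization identity holds in `E`, and `E → E^birat` is a functor.
[cite: MochizukiFrdI2008, Def. 4.5 (i) p.86] -/
theorem isFrobeniusNormalized_toBirat_birat_obj (hiso : IsOfIsotropicType F)
    (hB : IsFrobenioid (toElemZero hF hsq)) (hsqB : HasBiratSquares (toElemZero hF hsq))
    {X : Birat F hF hsq} (hX : IsFrobeniusNormalized (toElemZero hF hsq) X) :
    IsFrobeniusNormalized (toElemGp hB hsqB) ((toBirat (toElemZero hF hsq) hB hsqB).obj X) := by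
  intro φ hφ α hα
  obtain ⟨ψ, rfl⟩ := exists_toBirat_birat_map_eq hiso hB hsqB φ
  obtain ⟨a, ha⟩ := exists_toBirat_birat_map_eq hiso hB hsqB (X := X) (Y := X) (End.asHom α)
  -- bases and degrees along `E → E^birat`
  have hψb : IsBaseIdentity (toElemZero hF hsq) ψ := by
    have h1 : Base (toElemGp hB hsqB) ((toBirat (toElemZero hF hsq) hB hsqB).map ψ) = 𝟙 _ := hφ
    rw [base_toBirat_map] at h1
    exact h1
  have ha_mem : End.of a ∈ endSubmonoid (toElemZero hF hsq) X := by
    obtain ⟨h1, h2⟩ := hα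
    have h1' : Base (toElemGp hB hsqB) (End.asHom α) = 𝟙 _ := h1
    have h2' : degFr (toElemGp hB hsqB) (End.asHom α) = 1 := h2
    rw [← ha, base_toBirat_map] at h1'
    rw [← ha, degFr_toBirat_map] at h2'
    exact ⟨h1', h2'⟩
  have key := hX ψ hψb (End.of a) ha_mem
  have hd : degFr (toElemGp hB hsqB) ((toBirat (toElemZero hF hsq) hB hsqB).map ψ) =
      degFr (toElemZero hF hsq) ψ := degFr_toBirat_map ψ
  -- `α = (E → E^birat).mapEnd a`, so `α ^ d` is the image of `a ^ d`
  let M : End X →* End ((toBirat (toElemZero hF hsq) hB hsqB).obj X) :=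
    (toBirat (toElemZero hF hsq) hB hsqB).mapEnd X
  have hαeq : α = M (End.of a) := ha.symm
  have hpow : (show _ ⟶ _ from α ^ (degFr (toElemGp hB hsqB)
      ((toBirat (toElemZero hF hsq) hB hsqB).map ψ) : ℕ)) =
      (toBirat (toElemZero hF hsq) hB hsqB).map
        (show X ⟶ X from End.of a ^ (degFr (toElemZero hF hsq) ψ : ℕ)) := by
    rw [hd, hαeq, ← map_pow]
    rfl
  rw [hpow, hαeq]
  change (toBirat (toElemZero hF hsq) hB hsqB).map ψ ≫ (toBirat (toElemZero hF hsq) hB hsqB).map _ =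
    (toBirat (toElemZero hF hsq) hB hsqB).map a ≫ (toBirat (toElemZero hF hsq) hB hsqB).map ψ
  rw [← Functor.map_comp, ← Functor.map_comp]
  exact congrArg _ key

/-! ### Proposition 4.8 (iv) in the author's 2024 reading («model type») -/

/-- **The birationalization of a Frobenioid of isotropic and model type is of model type** (Def. 4.5 (i):
pre-model AND birationally Frobenius-normalized): the pre-model half is abc-iut-L6-t20's
`Birat.isOfPreModelType`; birational Frobenius-normalization of `C^birat` — i.e. Frobenius-normalization of
every `X^birat` in `(C^birat)^birat` — comes from that of `X = A^birat` in `C^birat` (the hypothesis) by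
`isFrobeniusNormalized_toBirat_birat_obj`. Here `C^birat` is a Frobenioid by W14 (`Birat.isFrobenioid`).
[cite: MochizukiFrdI2008, Prop. 4.8 (iv) p.88] -/
theorem isOfModelType_toElemZero (hiso : IsOfIsotropicType F) (hmod : IsOfModelType F hF hsq)
    (hsqB : HasBiratSquares (toElemZero hF hsq)) :
    IsOfModelType (toElemZero hF hsq) (isFrobenioid hF hsq hiso hmod.2) hsqB :=
  ⟨Birat.isOfPreModelType hF hsq hiso hmod.1,
    fun X => isFrobeniusNormalized_toBirat_birat_obj hiso _ hsqB (hmod.2 X.out)⟩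

/-- **[FrdI] Proposition 4.8 (iv) in the author's corrected 2024 reading** (*Comments on [FrdI]* (29)(iv):
"the phrase 'pre-model type' should read 'model type'"), for THE birationalization of a Frobenioid of
ISOTROPIC and MODEL type: `C^birat → F_{0_D}` is (a Frobenioid — W14 — and) of isotropic and model type.
The square-completion datum of `(C^birat)^birat` is discharged by abc-iut-L6-t6's
`hasBiratSquares_of_isFrobenioid`. [cite: MochizukiFrdI2008, Prop. 4.8 (iv) p.88] -/
theorem prop48iv_model (hiso : IsOfIsotropicType F) (hmod : IsOfModelType F hF hsq) :
    IsOfIsotropicType (toElemZero hF hsq) ∧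
      IsOfModelType (toElemZero hF hsq) (isFrobenioid hF hsq hiso hmod.2)
        (hasBiratSquares_of_isFrobenioid (isFrobenioid hF hsq hiso hmod.2)) :=
  ⟨isOfIsotropicType hiso, isOfModelType_toElemZero hiso hmod _⟩

end Birat

end PreFrobenioid

end Literature.AlgebraicGeometry.Frobenioids
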